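import Summits.QuantumFields.YangMills.Theorems.FibreConvexityTailTwoSidedTailLChernoffOnEvent

/-!
# Crux `TwoSidedTailL` (stmt-QuantumFields-25567) — LINE «birth», PROPOSED SKELETON v3 (lead seat ym-line-fct-p1 g2) — NOT REGISTERED

WHY A v3.  The registered open stub S1 = `stub_fibreMGF` (moment bound on the two-sided EVENT) is a COROLLARY OF THE CRUX
(`stub_fibreMGF_of_twoSidedTailL`, file `Theorems/FibreConvexityTailTwoSidedTailLFibreMGFOfCrux.lean`, p620509): on the event the observable
`X = |Ū^{j}(∂a) − 1|/g_{K−j}` is pinned in `[p, (b₂/b₀)p)` (tail constituent below, landed one-step window above), so a tail bound and a moment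
bound are the same statement.  With the landed S2 the registered split `S1 → S2` is therefore content-free: S1 ⟺ crux.

THE PROPOSED RESHAPE (one stub, same composition idea, genuinely intermediate).  S1' = `stub_windowMGF`: the SAME sub-Gaussian moment bound but
under the Gibbs measure restricted to the hierarchically-small WINDOW `{∀ i < j, Ū^{i} θ(K−i)-small} ∩ {Ū^{j+2} θ(K−j−2)-small}` — the two-sided
event WITHOUT its tail constituent.  This is exactly what the lever (fibre log-concavity + Herbst, centred at the constrained minimiser + mean–mode
gap ≤ p/4, where `bmin` is spent) would output, it is NOT implied by the crux (the window has Gibbs mass ≈ 1 and `X` is not bounded below on it: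
the bound asserts Gaussian concentration of `X` at all levels above `p/4` with a `(K, j)`-uniform proxy `σ`), and it implies S1 by positivity of
the integrand (`subGaussianOnEvent_of_superset`, landed p611300), hence the crux by S2.  Composition `TwoSidedTailL_of` below is kernel-checked
modulo the one `sorry`.

STATUS.  PROPOSED ONLY — the registry keeps skeleton v2 (stub `stub_fibreMGF`) until the director/critic rule (S1 is held behind the
instrument row JOB B of ym-r3-instr-1 by director order 2026-08-28T05:40Z).  R3 is a RECORD rung; nothing here bears on the Yang–Mills mass gap.
-/

noncomputable section

open MeasureTheory ProbabilityTheory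
open Literature.MathematicalPhysics.QuantumFieldTheory.Balaban1983to89
open Literature.MathematicalPhysics.QuantumFieldTheory.Balaban1983to89.Missing
open Literature.MathematicalPhysics.QuantumFieldTheory.Balaban1983to89.T4Continuum
open Literature.MathematicalPhysics.QuantumFieldTheory.Balaban1983to89.T3ContinuumYM3Torus
open Literature.MathematicalPhysics.QuantumFieldTheory.Balaban1983to89.T3UnitScaleTilt
open Literature.MathematicalPhysics.QuantumFieldTheory.Balaban1983to89.T3UnitLawDensityEML (ℰp measurableE_ℰp)

namespace Summit.QuantumFields.YangMills.Theorems.FibreConvexityTail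

/-- **PROPOSED STUB S1' `stub_windowMGF` (OPEN — the lever, XL).**  SUB-GAUSSIAN MOMENT BOUND ON THE HIERARCHICALLY-SMALL WINDOW: for every block
size `L` a profile floor `bmin` such that for all `b₀ ≥ bmin` (`0 < b₀`), `p₀ > 2` there is `0 < γ₁ ≤ 1` with, for every family `F` (`F.L = L`) and
`0 < γ ≤ γ₁`, constants `M ≥ 0`, `σ > 0` such that for all `K`, `1 ≤ j`, `j + 2 ≤ K`, every level-`j` plaquette `a` and every `t ≥ 0`:
`∫_{W} exp(t·|Ū^{j}(∂a) − 1|/g_{K−j}) dGibbs_K ≤ M·exp(t·p(g_{K−j})/4 + σ²t²/2)`, `W = {∀ i < j, PlaqSmall θ(K−i) (Ū^{i})} ∩ {PlaqSmall θ(K−j−2) (Ū^{j+2})}`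
(Mathlib `mgf` under the restricted measure).  Intended proof: outer convex window in Bałaban's regular chart of the constrained small-field fibre,
horizontal Bakry–Émery κ-convexity of `βS − log J − ½ log det Δ_A` with `κ·L^{2(j+2)}/β_K ≥ κ₀ > 0`, Herbst, mean–mode gap ≤ `p/4`. -/
theorem stub_windowMGF : ∀ (L : ℕ), ∃ bmin : ℝ, ∀ (b₀ p₀ : ℝ), bmin ≤ b₀ → 0 < b₀ → 2 < p₀ → ∃ γ₁ : ℝ, 0 < γ₁ ∧ γ₁ ≤ 1 ∧ ∀ (F : T3Family) (γ : ℝ), F.L = L → 0 < γ → γ ≤ γ₁ → ∃ (M σ : ℝ), 0 ≤ M ∧ 0 < σ ∧ ∀ (K j : ℕ), 1 ≤ j → j + 2 ≤ K → ∀ (a : Plaq (F.P K) j) (t : ℝ), 0 ≤ t → ProbabilityTheory.mgf (fun U => GaugeGroup.dist1 (GaugeField.plaqHol (Averaging.iter (fun i' => BlockAveraging.blockAvg (P := F.P K) (j := i') T3UnitLawDensityEML.ℰp) j U) a) / Real.sqrt (γ * ((F.L : ℝ)⁻¹) ^ (K - j))) ((T3UnitScaleTilt.gibbsK F T3UnitLawDensityEML.ℰp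 γ K).restrict ({U | ∀ i, i < j → PlaqSmall (T3UnitScaleTilt.θBal F.L γ b₀ p₀ (K - i)) (Averaging.iter (fun i' => BlockAveraging.blockAvg (P := F.P K) (j := i') T3UnitLawDensityEML.ℰp) i U)} ∩ {U | PlaqSmall (T3UnitScaleTilt.θBal F.L γ b₀ p₀ (K - (j + 2))) (Averaging.iter (fun i' => BlockAveraging.blockAvg (P := F.P K) (j := i') T3UnitLawDensityEML.ℰp) (j + 2) U)})) t ≤ M * Real.exp (t * (B10.pFun b₀ p₀ (Real.sqrt (γ * ((F.L : ℝ)⁻¹) ^ (K - j))) / 4) + σ ^ 2 * t ^ 2 / 2) := by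
  sorry

/-- **COMPOSITION `TwoSidedTailL_of` (v3)** — the crux BY NAME from S1' (`stub_windowMGF`, open) through the landed monotonicity
`subGaussianOnEvent_of_superset` (the two-sided event is the window intersected with the tail constituent) and the landed S2
`stub_chernoffOnEvent` (p611300): constants `C = M`, `A = 0`, `c = 9/(32σ²)`. -/
theorem TwoSidedTailL_of : Summit.QuantumFields.YangMills.Theses.FibreConvexityTail.TwoSidedTailL := by
  rw [twoSidedTailL_iff]
  intro L
  obtain ⟨bmin, hb⟩ := stub_windowMGF L
  refine ⟨bmin, fun b₀ p₀ hbmin hb₀ hp₀ => ?_⟩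
  obtain ⟨γ₁, hγ₁, hγ₁1, hF⟩ := hb b₀ p₀ hbmin hb₀ hp₀
  refine ⟨γ₁, hγ₁, hγ₁1, fun F γ hFL hγ hγle => ?_⟩
  obtain ⟨M, σ, hM, hσ, hK⟩ := hF F γ hFL hγ hγle
  refine ⟨M, 0, 9 / (32 * σ ^ 2), hM, by positivity, fun K j hj hjK a => ?_⟩
  refine stub_chernoffOnEvent F γ b₀ p₀ hγ hb₀ K j a M σ hM hσ
    (subGaussianOnEvent_of_superset F hγ b₀ p₀ K j a ?_ (hK K j hj hjK a))
  exact fun U hU => ⟨hU.1.2, hU.2⟩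

end Summit.QuantumFields.YangMills.Theorems.FibreConvexityTail

end
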